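import Literature.AlgebraicGeometry.Frobenioids.BiratSubfunctor
import Literature.AlgebraicGeometry.Frobenioids.RationalFunctionSubfunctors
import Literature.AlgebraicGeometry.Frobenioids.ModelFrobenioidFunctor
import Literature.AlgebraicGeometry.Frobenioids.PerfFactorial
import Literature.AlgebraicGeometry.Frobenioids.BaseFrobeniusSections
import Literature.AlgebraicGeometry.Frobenioids.PreFrobenioidDataOfFunctor
import Literature.AlgebraicGeometry.Frobenioids.DivisorMonoidCategoryTheoreticityDefs
import Literature.AlgebraicGeometry.Frobenioids.BirationalNormalizationExample
import HarnessLib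

/-!
# Frobenioids I, §5: Proposition 5.3 (Realifications of Frobenioids), Corollary 5.4, Remark 5.2.1

Mochizuki, *The geometry of Frobenioids I: the general theory*, Kyushu J. Math. **62** (2008)
293–400, §5, Proposition 5.3 p. 103 (proof p. 103 ll. 34–36), Corollary 5.4 pp. 103–104 (proof
p. 104 ll. 21–24), Remark 5.2.1 p. 103 [cite: MochizukiFrdI2008, Prop. 5.3 p.103]
[cite: MochizukiFrdI2008, Cor. 5.4 p.103] [cite: MochizukiFrdI2008, Rem. 5.2.1 p.103].

**Setting (p. 96).** `Φ` a divisorial monoid on a connected, totally epimorphic `D`; `C → F_Φ` a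
Frobenioid (`F : C ⥤ ElemFrobenioid Φ`, hypothesis `IsFrobenioid F`).

**Vocabulary (read-only).** `C^un-tr = (PreFrobenioidData.ofFunctor Φ F).Untr` (Def. 3.1 (iv)),
`PerfectionData` (Def. 3.1 (iii) interface), `BiratData` with `phiBirat`/`divBirat`, `RSParams`,
`IsOfRationallyStandardType`, `IsOfBiratFrobeniusNormalizedType`, `IsStrictlyRational`, `IsDivSlim`,
`IsOfStandardType` (files `BaseCategoryTheoreticityDefs.lean`, `DivisorMonoidCategoryTheoreticityDefs.lean`,
seat abc-iut-L1-t3; names frozen by L1-lead W2-4 / 19:48Z); `IsOfPreModelType` (Def. 2.7 (iii), file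
`BaseFrobeniusSections.lean`, seat abc-iut-L1-t2); `Φ^birat = biratSubfunctor F` (CANONICAL, RULING
C5′; every `BiratData.phiBirat` instantiates to it); `RealificationData` (`Φ^rlf` as a monoid on `D`,
`RationalFunctionSubfunctors.lean`, `TODO-merge: abc-iut-L1-t2`). "Of model type" (Def. 4.5 (i) =
pre-model AND birationally Frobenius-normalized) is bound BY NAME as the conjunction
`IsOfPreModelType G ∧ IsOfBiratFrobeniusNormalizedType B` for a structure functor `G` and a
birationalization datum `B` of its operations (W2-8 (3): no free `Prop` binders).

**SCHEMA-LABEL RULE (L1-lead W2-8 (5)).** A statement with a data-only interface PARAMETER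
(`PerfectionData`, `BiratData`, `RSParams`, operations `SU` / structure functor `FU` of `C^un-tr`, the
functors `ι_i : C_i → C_i^rlf`, `RealificationData`) is a SCHEMA — faithful to print only when
instantiated with THE construction (owners: abc-iut-L1-t3 / d9 for `C^pf`, `C^birat`; Prop. 3.3 (iv)
for `C^un-tr → F_Φ`; abc-iut-L1-t2 for `Φ^rlf`); not a closed citable fact. Each such declaration says
"SCHEMA" in its docstring.

**Contents.** `realification F R` (**`C^rlf`**, Prop. 5.3: the model Frobenioid of `(Φ^rlf, ℝ · Φ^birat)`),
`untrModel`, `untrPfModel`; `Prop53_untr`, `Prop53_untrPf`, `Prop53_diagram` (READING of the printed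
2 × 3 diagram, whose layout is lost in our text render: verticals `C^istr → C^un-tr`, `C^pf → (C^un-tr)^pf`);
`PreservesBaseIsoIfGroupLike`, `Cor54` (FLAG, recorded not typed: the final clause "the formation of
`Ψ^rlf` is 1-compatible with the diagram of Prop. 5.3" needs `Ψ^pf`, `Ψ^un-tr` of Cor. 4.11 (iii)/(iv));
`Remark521` (over a functor standing for the Frobenioid of Example 4.6) and its instantiation
`Remark521_ex46` at seat abc-iut-L1-t8's `Ex46.toElem` (`BirationalNormalizationExample.lean`). All are
named `Prop` statements. No statement of the paper is strengthened.
-/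

namespace Literature.AlgebraicGeometry.Frobenioids

open CategoryTheory Opposite

universe w v v' u u'

namespace PreFrobenioid

variable {D : Type u} [Category.{v} D] {Φ : Dᵒᵖ ⥤ CommMonCat.{w}}
  {C : Type u'} [Category.{v'} C] (F : C ⥤ ElemFrobenioid Φ)

/-! ### Proposition 5.3: the realification `C^rlf` and the model descriptions -/

/-- "`Φ` is perf-factorial" (Def. 2.4 (i), objectwise as in Def. 1.1 (ii)).
[cite: MochizukiFrdI2008, Prop. 5.3 p.103] -/
abbrev IsPerfFactorialOn (Φ : Dᵒᵖ ⥤ CommMonCat.{w}) : Prop :=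
  Objectwise (fun M _ => IsPerfFactorial M) Φ

/-- **`C^rlf`, the realification of the Frobenioid `C`** (Prop. 5.3 p. 103): "the model Frobenioid
associated to the divisor monoid `Φ^rlf` [i.e., the 'realification' of Definition 2.4, (i)] and the
rational function monoid `ℝ · Φ^birat ⊆ (Φ^rlf)^gp`", for `Φ` perf-factorial; `Φ^rlf` and the
`ℝ`-structure are supplied by `R : RealificationData Φ` (SCHEMA in `R`; `TODO-merge: abc-iut-L1-t2`),
`Φ^birat` is `biratSubfunctor F`. Structure functor to `F_{Φ^rlf}`: `ModelFrobenioid.toElem`.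
[cite: MochizukiFrdI2008, Prop. 5.3 p.103] -/
abbrev realification (R : RealificationData Φ) : Type (max u w) := R.RlfModelOf (biratSubfunctor F)

/-- "The model Frobenioid associated to the divisor monoid `Φ` and the rational function monoid
`Φ^birat`" (Prop. 5.3 p. 103) — by Prop. 5.3 it is `C^un-tr`. [cite: MochizukiFrdI2008, Prop. 5.3 p.103] -/
abbrev untrModel : Type (max u w) := (biratSubfunctor F).ModelOf

/-- "The model Frobenioid associated to the divisor monoid `Φ^pf` and the rational function monoid
`ℚ · Φ^birat = Φ^birat ⊗_ℤ ℚ = (Φ^birat)^pf`" (Prop. 5.3 p. 103) — by Prop. 5.3 it is `(C^un-tr)^pf`.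
[cite: MochizukiFrdI2008, Prop. 5.3 p.103] -/
abbrev untrPfModel : Type (max u w) := (biratSubfunctor F).PfModelOf

/-- **Proposition 5.3**, "Moreover", first half (named statement; SCHEMA in `FU`, `BU`): "the Frobenioid
`C^un-tr` … is of model type and may be obtained as the model Frobenioid associated to the divisor
monoid `Φ` … and the rational function monoid `Φ^birat`" — for the unit-trivialisation `C^un-tr` of
Def. 3.1 (iv) with its structure functor `FU : C^un-tr → F_Φ` (Prop. 3.3 (iv), characterised by
`toUntr ⋙ FU = ι ⋙ F`) and a birationalization datum `BU` of `C^un-tr`: `C^un-tr` is of model type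
(pre-model, Def. 2.7 (iii), AND birationally Frobenius-normalized, Def. 4.5 (i)) and there is an
equivalence `C^un-tr ⥲ (model of (Φ, Φ^birat))` compatible with the functors to `F_Φ`.
[cite: MochizukiFrdI2008, Prop. 5.3 p.103] -/
def Prop53_untr (FU : (PreFrobenioidData.ofFunctor Φ F).Untr ⥤ ElemFrobenioid Φ)
    (BU : (PreFrobenioidData.ofFunctor Φ FU).BiratData) : Prop :=
  IsFrobenioid F →
    (PreFrobenioidData.ofFunctor Φ F).toUntr ⋙ FU = (PreFrobenioidData.ofFunctor Φ F).istrι ⋙ F →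
      (IsOfPreModelType FU ∧ PreFrobenioidData.IsOfBiratFrobeniusNormalizedType BU) ∧
        ∃ e : (PreFrobenioidData.ofFunctor Φ F).Untr ≌ untrModel F,
          Nonempty (e.functor ⋙ ModelFrobenioid.toElem Φ _ _ ≅ FU)

/-- **Proposition 5.3**, "Moreover", second half (named statement; SCHEMA in `SU`, `PU`, `IsOfModelType`):
"(respectively, `(C^un-tr)^pf`) is of model type and may be obtained as the model Frobenioid
associated to … `Φ^pf` … and … `ℚ · Φ^birat = (Φ^birat)^pf`" — over operations `SU` and a perfection
datum `PU` of `C^un-tr` (Def. 3.1 (iii) interface); "of model type" for the perfection is the predicate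
schema `IsOfModelType` (ONE predicate on operations, Def. 4.5 (i)) applied to `PU.ops`; the equivalence
is required to lie over `D`. [cite: MochizukiFrdI2008, Prop. 5.3 p.103] -/
def Prop53_untrPf
    (IsOfModelType : ∀ {X : Type u'} [Category.{v'} X], PreFrobenioidData.{w} X D → Prop)
    (SU : PreFrobenioidData.{w} (PreFrobenioidData.ofFunctor Φ F).Untr D) (PU : PerfectionData SU) :
    Prop :=
  IsFrobenioid F →
    IsOfModelType PU.ops ∧
      ∃ e : PU.Pf ≌ untrPfModel F,
        Nonempty (e.functor ⋙ ModelFrobenioid.baseFunctor _ _ _ ≅ PU.ops.base)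

/-- **Proposition 5.3**, "In particular" (named statement; SCHEMA in `P`, `SU`, `PU`; READING of the
diagram in the module docstring): for `C` of Frobenius-isotropic type, with `P` a perfection datum of
`C` (`P.toPf : C → C^pf`) and `PU` one of `C^un-tr`, "there is a natural 1-commutative diagram of
functors `C → C^istr → C^pf` over `C^un-tr → (C^un-tr)^pf → C^rlf`": there is a functor
`C^pf → (C^un-tr)^pf` making the square with `C^istr → C^un-tr` (Def. 3.1 (iv)) and `C^istr ⊆ C → C^pf`
1-commute; the row functor `(C^un-tr)^pf → C^rlf` "arises naturally from the construction of the
realification" (induced by `Φ^pf → Φ^rlf`, `(Φ^birat)^pf → ℝ · Φ^birat`).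
[cite: MochizukiFrdI2008, Prop. 5.3 p.103] -/
def Prop53_diagram (P : PerfectionData (PreFrobenioidData.ofFunctor Φ F))
    (SU : PreFrobenioidData.{w} (PreFrobenioidData.ofFunctor Φ F).Untr D) (PU : PerfectionData SU) :
    Prop :=
  IsFrobenioid F → IsOfType (IsFrobeniusIsotropic F) →
    ∃ pfUntr : P.Pf ⥤ PU.Pf,
      Nonempty ((PreFrobenioidData.ofFunctor Φ F).istrι ⋙ P.toPf ⋙ pfUntr ≅
        (PreFrobenioidData.ofFunctor Φ F).toUntr ⋙ PU.toPf)

/-! ### Corollary 5.4 (Category-theoreticity of the Realification) -/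

section Cor54

variable {D₁ : Type u} [Category.{v} D₁] {Φ₁ : D₁ᵒᵖ ⥤ CommMonCat.{w}}
  {C₁ : Type u'} [Category.{v'} C₁] (F₁ : C₁ ⥤ ElemFrobenioid Φ₁)
  {D₂ : Type u} [Category.{v} D₂] {Φ₂ : D₂ᵒᵖ ⥤ CommMonCat.{w}}
  {C₂ : Type u'} [Category.{v'} C₂] (F₂ : C₂ ⥤ ElemFrobenioid Φ₂)

/-- "If `C₁`, `C₂` are of group-like type, then we also assume that both `Ψ` and some quasi-inverse to
`Ψ` preserve base-isomorphisms" (Cor. 5.4 p. 103; Cor. 5.7 p. 108).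
[cite: MochizukiFrdI2008, Cor. 5.4 p.103] -/
def PreservesBaseIsoIfGroupLike (Ψ : C₁ ≌ C₂) : Prop :=
  IsOfType (IsGroupLikeObj F₁) → IsOfType (IsGroupLikeObj F₂) →
    (∀ ⦃A B : C₁⦄ (f : A ⟶ B), IsBaseIso F₁ f → IsBaseIso F₂ (Ψ.functor.map f)) ∧
      ∀ ⦃A B : C₂⦄ (g : A ⟶ B), IsBaseIso F₂ g → IsBaseIso F₁ (Ψ.inverse.map g)

/-- **Corollary 5.4** (Category-theoreticity of the Realification; named statement; SCHEMA in
`Rp_i`, `R_i`, `ι_i`). Hypotheses: for `i = 1, 2`, `Φ_i` a perf-factorial divisorial monoid on a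
connected, totally epimorphic, Div-slim `D_i` (`IsDivSlim`, Def. 4.5 (iv)), `C_i → F_{Φ_i}` a Frobenioid
of rationally standard type (`IsOfRationallyStandardType _ Rp_i`, Def. 4.5 (iii), over its interface
parameters `Rp_i : RSParams`), `Ψ : C₁ ⥲ C₂` an equivalence preserving base-isomorphisms both ways in
the group-like case; `R_i` realification data and `ι_i : C_i → C_i^rlf` the natural functors of
Prop. 5.3 (PARAMETERS — the composite of the Prop. 5.3 diagram; closed instantiation pending the
functor-level `C → C^rlf`). Conclusion: "there exists a 1-unique functor `Ψ^rlf : C₁^rlf → C₂^rlf` that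
fits into a 1-commutative diagram [`C₁ → C₂` over `C₁^rlf → C₂^rlf`; the horizontal arrows are
equivalences of categories]. Moreover, each of the composite functors of this diagram is rigid."
FLAG: the final 1-compatibility clause with the Prop. 5.3 diagram is recorded, not typed (module
docstring). [cite: MochizukiFrdI2008, Cor. 5.4 p.103] -/
def Cor54 (Rp₁ : (PreFrobenioidData.ofFunctor Φ₁ F₁).RSParams)
    (Rp₂ : (PreFrobenioidData.ofFunctor Φ₂ F₂).RSParams) (R₁ : RealificationData Φ₁)
    (R₂ : RealificationData Φ₂) (ι₁ : C₁ ⥤ realification F₁ R₁) (ι₂ : C₂ ⥤ realification F₂ R₂)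
    (Ψ : C₁ ≌ C₂) : Prop :=
  IsFrobenioid F₁ → IsFrobenioid F₂ → IsPerfFactorialOn Φ₁ → IsPerfFactorialOn Φ₂ →
    (PreFrobenioidData.ofFunctor Φ₁ F₁).IsDivSlim → (PreFrobenioidData.ofFunctor Φ₂ F₂).IsDivSlim →
    (PreFrobenioidData.ofFunctor Φ₁ F₁).IsOfRationallyStandardType Rp₁ →
    (PreFrobenioidData.ofFunctor Φ₂ F₂).IsOfRationallyStandardType Rp₂ →
    PreservesBaseIsoIfGroupLike F₁ F₂ Ψ →
      ∃ Ψrlf : realification F₁ R₁ ⥤ realification F₂ R₂,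
        Nonempty (ι₁ ⋙ Ψrlf ≅ Ψ.functor ⋙ ι₂) ∧ Ψrlf.IsEquivalence ∧
          (∀ Ψ' : realification F₁ R₁ ⥤ realification F₂ R₂,
            Nonempty (ι₁ ⋙ Ψ' ≅ Ψ.functor ⋙ ι₂) → Nonempty (Ψ' ≅ Ψrlf)) ∧
          IsRigidFunctor (ι₁ ⋙ Ψrlf) ∧ IsRigidFunctor (Ψ.functor ⋙ ι₂)

end Cor54

/-! ### Remark 5.2.1 -/

section Remark521

variable {D₀ : Type u} [Category.{v} D₀] {Φ₀ : D₀ᵒᵖ ⥤ CommMonCat.{w}}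
  {C₀ : Type u'} [Category.{v'} C₀]

/-- **Remark 5.2.1** (named statement; SCHEMA in `F₀`, `B₀`, `Supp`): "It follows formally from
Theorem 5.2, (ii), (iv), that the Frobenioid '`C`' of Example 4.6 constitutes an example of a Frobenioid
of isotropic, standard, and [strictly] rational type, which is not of group-like or model type." Here
`F₀ : C₀ → F_{Φ₀}` stands for the Frobenioid of Example 4.6 (seat abc-iut-L1-t8, `TODO-merge`:
instantiate with its construction) with a birationalization datum `B₀` and a support predicate `Supp`
(Def. 2.4 (i)(d)); "strictly rational" is Def. 4.5 (ii) (`IsStrictlyRational`), "model type" is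
pre-model (Def. 2.7 (iii)) AND birationally Frobenius-normalized (Def. 4.5 (i)).
[cite: MochizukiFrdI2008, Rem. 5.2.1 p.103] -/
def Remark521 (F₀ : C₀ ⥤ ElemFrobenioid Φ₀) (B₀ : (PreFrobenioidData.ofFunctor Φ₀ F₀).BiratData)
    (Supp : ∀ {X : D₀}, (PreFrobenioidData.ofFunctor Φ₀ F₀).Mon X →
      Primes ((PreFrobenioidData.ofFunctor Φ₀ F₀).Mon X) → Prop) : Prop :=
  IsFrobenioid F₀ ∧ IsOfIsotropicType F₀ ∧ (PreFrobenioidData.ofFunctor Φ₀ F₀).IsOfStandardType ∧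
    (∀ A : C₀, PreFrobenioidData.IsStrictlyRational B₀ Supp A) ∧
    ¬ IsOfType (IsGroupLikeObj F₀) ∧
    ¬ (IsOfPreModelType F₀ ∧ PreFrobenioidData.IsOfBiratFrobeniusNormalizedType B₀)

/-- **Remark 5.2.1 at THE Frobenioid of Example 4.6** (instantiation of `Remark521` with
`Ex46.toElem P : C → F_Φ`, file `BirationalNormalizationExample.lean`, seat abc-iut-L1-t8), for a datum
all of whose `ξ_p = Ξ(p)` are nonzero (Ex. 4.6 p. 87: "if the `ξ_p ≠ 0` … then `C` fails to be of
birationally Frobenius-normalized type" — the case the Remark is about); SCHEMA only in the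
birationalization datum `B₀` and the support predicate `Supp`. [cite: MochizukiFrdI2008, Rem. 5.2.1 p.103] -/
def Remark521_ex46 {G : Type} [AddCommGroup G] (P : Ex46.Datum G)
    (B₀ : (PreFrobenioidData.ofFunctor Ex46.Φ (Ex46.toElem P)).BiratData)
    (Supp : ∀ {X}, (PreFrobenioidData.ofFunctor Ex46.Φ (Ex46.toElem P)).Mon X →
      Primes ((PreFrobenioidData.ofFunctor Ex46.Φ (Ex46.toElem P)).Mon X) → Prop) : Prop :=
  (∀ p : ℕ+, (p : ℕ).Prime → P.Ξ p ≠ 0) → Remark521 (Ex46.toElem P) B₀ Supp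

end Remark521

end PreFrobenioid

end Literature.AlgebraicGeometry.Frobenioids
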